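import Literature.AlgebraicTopology.SingularHomology.FiniteCoverTransferAdjointPairing
import Literature.AlgebraicGeometry.HodgeTheory.HodgeRiemannPolarizabilityProofs
import Literature.AlgebraicGeometry.HodgeTheory.BettiUniverseAxioms
import Literature.AlgebraicGeometry.Motives.HodgeStructurePolarizationNormalSemisimple
import HarnessLib

/-!
# A correspondence operator on `H¹` of a smooth projective surface preserving a Kähler class is semisimple

Let `X/ℂ` be a smooth projective SURFACE with a Kähler–rational datum `D` (tree `KaehlerRationalDatum 2 X`: a
rational class `η ∈ H²(X(ℂ); ℚ)` a real multiple of which is Kähler, with the Hard Lefschetz package — the datum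
behind `smoothProjective_hodgeStructure_isPolarizable_holds`), and let `p₁, p₂ : E → X(ℂ)` be two finite
coverings by ONE space `E` with `H⁴(E; ℚ)` a line (e.g. `E` a connected closed oriented `4`-manifold: a
correspondence `X ← E → X` such as a Hecke pair `X_Γ ← X_{Γ'} → X_Γ`).  Write `T = τ'₁ ∘ p₂^*` for the
correspondence operator on `H¹(X(ℂ); ℚ)` and `T' = τ'₂ ∘ p₁^*` for its transpose.

* §1 `polarizationForm_one_apply`, `polarizationForm_one_apply_two` — on `H¹` every class is primitive, so the
  polarisation form of the Lefschetz package is the plain Hodge–Riemann pairing; for a surface,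
  **`Q(x, y) = τ((κ ⌣ x) ⌣ y)`** (Voisin, §6.3.2 / §7.1.2).
* §2 `KaehlerRationalDatum.exists_isAdjointPair_form_one` — if **`p₁^* η = p₂^* η`** (the Kähler class is
  invariant under the correspondence) then `∃ r ≠ 0` with `Q(T u, v) = Q(u, r • T' v)`: `T` has the RATIONAL
  `Q`-adjoint `r • T'` for the polarisation form OF RECORD `D.form hX 1` (by §1 and the Galois-free adjointness
  `IsFiniteCover.exists_isAdjointPair_transferMap_comp_map_smul` of `FiniteCoverTransferAdjointPairing`).
* §3 `isSemisimple_transferMap_comp_map_one` — if moreover `T` is a HODGE endomorphism of `H¹(X(ℂ); ℚ)`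
  (`T ∈ (BettiUniverse.hodge hHD hX 1).endAlg`) and **commutes with `T'`**, then **`T` is semisimple**: it is
  `Q`-normal for the polarisation `D.polarization hX …` of the weight-one Hodge structure, and a `Q`-normal Hodge
  endomorphism of a polarised Hodge structure is semisimple (tree
  `Motives.HodgeStructure.Polarization.isSemisimple_of_isAdjointPair_of_commute`).

This is the classical route to the semisimplicity of Hecke operators on `H¹` of a compact Shimura surface:
`T_γ = τ'_{f₁} ∘ g^*` for the Hecke pair `(f₁, g) : X_{Γ'} ⇉ X_Γ`, `ᵗT_γ = T_{γ⁻¹}`, and the Hecke algebra of an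
inverse-closed commuting family is `Q`-self-adjoint up to scalars (Shimura 1971, §3.4 (3.4.5); the Petersson /
Hodge–Riemann normality argument).  What this file leaves as hypotheses is exactly: the invariant Kähler class,
Hodge-compatibility of `T`, and `Commute T T'`.

Cell pub-hodgecm2, lane «L-BYPASS» (kernel text by the seat pub-hodgecm2-s2crux-idea-2, probes `RA-v20`, `RA-v23` Part C,
`RA-v24` Part D, gen 7; filed by b10).  Theorems only; no named fact (`hHD : exists_isReal_hodgeModel` is the tree's
model-choice hypothesis, discharged by `exists_isReal_hodgeModel_holds`).

References: C. Voisin, *Hodge Theory and Complex Algebraic Geometry I* (2002), §6.2.3 Def. 6.24, §6.3.2, §7.1.2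
[VoisinHodgeI2002]; H. Lange, *Abelian Varieties over the Complex Numbers* (2023), §2.4.1 Prop. 2.4.2 and Thm. 2.4.9
(positivity of the Rosati involution ⇒ semisimplicity) [Lange2023AbelianVarietiesC]; A. Hatcher, *Algebraic Topology*
(2002), §3.G [HatcherAT2002]; G. Shimura, *Introduction to the Arithmetic Theory of Automorphic Functions* (1971),
§3.4 (3.4.5) [Shimura1971].
-/

noncomputable section

open CategoryTheory

namespace Literature.AlgebraicGeometry.HodgeTheory

/-! ## §1 The polarisation form on `H¹` -/

open Literature.AlgebraicTopology.SingularHomology Literature.Geometry.Kaehler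

universe u v

variable {Y : Type u} [TopologicalSpace Y] {R : Type v} [CommRing R]
variable {κ : singularCohomology R R Y 2} {n : ℕ}

/-- **Every class of degree `1` is primitive** (`n ≥ 1`): `Lⁿ : H¹ → H^{2n+1} = 0`.
[cite: VoisinHodgeI2002, §6.2.3 Def. 6.24] -/
theorem mem_primitiveClasses_one (hvan : ∀ m, 2 * n < m → Subsingleton (singularCohomology R R Y m))
    (hn : 1 ≤ n) (x : singularCohomology R R Y 1) :
    x ∈ primitiveClasses κ n 1 := by
  rw [mem_primitiveClasses]
  refine ⟨fun h => absurd h (by omega), fun r m h hr => ?_⟩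
  haveI : Subsingleton (singularCohomology R R Y m) := hvan m (by omega)
  exact Subsingleton.elim _ _

/-- **The polarisation form on `H¹` is the Hodge–Riemann pairing**: for `n ≥ 1`, `1 + s = n`,
`Q(x, y) = τ(Lˢ x ∪ y)` on `H¹(Y; R)` (only the Lefschetz index `(1, 0)` occurs, `ξ_{(1,0)} = id` on the
primitive `H¹`, and the sign is `(-1)^{1·0/2} = 1`). [cite: VoisinHodgeI2002, §6.3.2 and §7.1.2] -/
theorem polarizationForm_one_apply (hL : HasHardLefschetzProperty κ n)
    (hvan : ∀ m, 2 * n < m → Subsingleton (singularCohomology R R Y m))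
    (hn : 1 ≤ n) (τ : singularCohomology R R Y (2 * n) →ₗ[R] R)
    {s : ℕ} (hs : 1 + s = n) (hm : 1 + 2 * s = 2 * n - 1) (h : (2 * n - 1) + 1 = 2 * n)
    (x y : singularCohomology R R Y 1) :
    polarizationForm κ n hL hvan τ 1 x y = τ (cupProduct h (lefschetzPowTo κ s 1 (2 * n - 1) hm x) y) := by
  let p : {p : ℕ × ℕ // p.1 + 2 * p.2 = 1} := ⟨(1, 0), rfl⟩
  have hp : p.1.1 + p.1.2 ≤ n := hn
  have hx : x ∈ primitiveClasses κ n p.1.1 := mem_primitiveClasses_one hvan hn x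
  have hy : y ∈ primitiveClasses κ n p.1.1 := mem_primitiveClasses_one hvan hn y
  have ex : lefschetzPowTo κ p.1.2 p.1.1 1 p.2 x = x := lefschetzPowTo_zero_apply κ 1 x
  have ey : lefschetzPowTo κ p.1.2 p.1.1 1 p.2 y = y := lefschetzPowTo_zero_apply κ 1 y
  have key := polarizationForm_lefschetzPowTo_left hL hvan τ p hp hx y
  rw [ex] at key
  rw [key]
  have hξ : primitivePart κ n hL hvan p y = y := by
    have := primitivePart_lefschetzPowTo_of_mem hL hvan p hp hy
    rwa [ey] at this
  rw [hξ]
  change hodgeRiemannPairing κ n τ 1 x y = _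
  rw [hodgeRiemannPairing_apply τ hs hm h x y]
  norm_num

/-- **Surface case** (`n = 2`): `Q(x, y) = τ((κ ∪ x) ∪ y)` on `H¹(Y; R)` — the polarisation form of
record on `H¹` of a smooth projective surface is the cup pairing twisted by the Kähler class.
[cite: VoisinHodgeI2002, §6.3.2 and §7.1.2] -/
theorem polarizationForm_one_apply_two {κ : singularCohomology R R Y 2} (hL : HasHardLefschetzProperty κ 2)
    (hvan : ∀ m, 2 * 2 < m → Subsingleton (singularCohomology R R Y m))
    (τ : singularCohomology R R Y (2 * 2) →ₗ[R] R) (x y : singularCohomology R R Y 1) :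
    polarizationForm κ 2 hL hvan τ 1 x y =
      τ (cupProduct (show (2 * 2 - 1) + 1 = 2 * 2 by norm_num)
        (lefschetzOperator κ (show 2 + 1 = 2 * 2 - 1 by norm_num) x) y) := by
  rw [polarizationForm_one_apply hL hvan (by norm_num) τ (s := 1) (by norm_num) (by norm_num) (by norm_num) x y,
    lefschetzPowTo_succ_apply κ 0 1 1 (2 * 2 - 1) (by norm_num) (by norm_num) (by norm_num) x]
  rfl

/-! ## §2 The correspondence operator has a rational `Q`-adjoint -/

namespace KaehlerRationalDatum

open Literature.AlgebraicTopology.SingularHomology.IsFiniteCover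

variable {X : Motives.SchemeOver ℂ} (D : KaehlerRationalDatum 2 X)

/-- The normalised rational trace does not vanish (it is `±1` on the chosen top class). [cite: VoisinHodgeI2002, §7.1.2] -/
theorem ratTrace_ratTopVec_ne_zero {n : ℕ} {X : Motives.SchemeOver ℂ} (D : KaehlerRationalDatum n X)
    (hX : Motives.IsSmoothProjective n X) : D.ratTrace hX (ratTopVec hX) ≠ 0 := by
  rw [ratTrace, LinearMap.smul_apply, ratTopCoord, lineCoord_self, smul_eq_mul, mul_one, traceSign]
  split_ifs <;> norm_num

/-- **Capstone.**  `X/ℂ` a smooth projective surface, `D` a Kähler–rational datum (`η` its rational Kähler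
class, `Q = D.form hX 1` the polarisation form of record on `H¹(X(ℂ); ℚ)`), `p₁, p₂ : E → X(ℂ)` finite
coverings of the same space `E` with `H⁴(E; ℚ)` a line and `p₁^* η = p₂^* η`.  Then the correspondence
operator `T = τ'₁ ∘ p₂^*` on `H¹(X(ℂ); ℚ)` has the RATIONAL `Q`-adjoint `r • (τ'₂ ∘ p₁^*)` for some `r ≠ 0`.
[cite: HatcherAT2002, §3.G p. 321 and Prop. 3.10] [cite: VoisinHodgeI2002, §7.1.2] -/
theorem exists_isAdjointPair_form_one (hX : Motives.IsSmoothProjective 2 X)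
    {E : Type} [TopologicalSpace E] {p₁ p₂ : C(E, Motives.ComplexPoints X)}
    (c₁ : IsFiniteCover p₁) (c₂ : IsFiniteCover p₂)
    (hE : Module.finrank ℚ (singularCohomology ℚ ℚ E (2 * 2)) = 1)
    (hη : singularCohomology.map ℚ ℚ p₁ 2 D.η = singularCohomology.map ℚ ℚ p₂ 2 D.η) :
    ∃ r : ℚ, r ≠ 0 ∧ LinearMap.IsAdjointPair (D.form hX 1) (D.form hX 1)
      ((c₁.transferMap 1).hom ∘ₗ (singularCohomology.map ℚ ℚ p₂ 1).hom)
      (r • ((c₂.transferMap 1).hom ∘ₗ (singularCohomology.map ℚ ℚ p₁ 1).hom) :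
        singularCohomology ℚ ℚ (Motives.ComplexPoints X) 1 →ₗ[ℚ]
          singularCohomology ℚ ℚ (Motives.ComplexPoints X) 1) :=
  exists_isAdjointPair_transferMap_comp_map_smul c₁ c₂ (k := 1) (s := 2) (m := 2 * 2 - 1) (t := 2 * 2)
    (by norm_num) (by norm_num) hE (D.ratTrace hX) (D.ratTrace_ratTopVec_ne_zero hX) D.η hη (D.form hX 1)
    (fun u v => polarizationForm_one_apply_two (D.hLℚ hX) (subsingleton_of_lt hX ℚ) (D.ratTrace hX) u v)

end KaehlerRationalDatum

/-! ## §3 Semisimplicity of a `Q`-normal Hodge correspondence operator on `H¹` -/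

section F1Door

open Literature.AlgebraicTopology.SingularHomology.IsFiniteCover

/-- **`τ'₁ ∘ p₂^*` is semisimple on `H¹(X(ℂ); ℚ)`** for a smooth projective surface `X/ℂ` (`hHD`), two finite
coverings `p₁, p₂ : E → X(ℂ)` with `H⁴(E; ℚ)` a line, a Kähler–rational datum `D` with `p₁^* η = p₂^* η`,
PROVIDED `T := τ'₁ ∘ p₂^*` is a Hodge endomorphism and commutes with `τ'₂ ∘ p₁^*`: `T` is then
`Q`-normal for the polarisation of record, and `Polarization.isSemisimple_of_isAdjointPair_of_commute` applies. [cite: VoisinHodgeI2002, §7.1.2]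
[cite: Lange2023AbelianVarietiesC, §2.4.1 Prop. 2.4.2 and Thm. 2.4.9] -/
theorem isSemisimple_transferMap_comp_map_one (hHD : exists_isReal_hodgeModel) {X : Motives.SchemeOver ℂ}
    (hX : Motives.IsSmoothProjective 2 X) (D : KaehlerRationalDatum 2 X)
    {E : Type} [TopologicalSpace E] {p₁ p₂ : C(E, Motives.ComplexPoints X)}
    (c₁ : IsFiniteCover p₁) (c₂ : IsFiniteCover p₂)
    (hE : Module.finrank ℚ (singularCohomology ℚ ℚ E (2 * 2)) = 1)
    (hη : singularCohomology.map ℚ ℚ p₁ 2 D.η = singularCohomology.map ℚ ℚ p₂ 2 D.η)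
    (hT : ((c₁.transferMap 1).hom ∘ₗ (singularCohomology.map ℚ ℚ p₂ 1).hom) ∈
      (BettiUniverse.hodge hHD hX 1).endAlg)
    (hc : Commute ((c₁.transferMap 1).hom ∘ₗ (singularCohomology.map ℚ ℚ p₂ 1).hom)
      ((c₂.transferMap 1).hom ∘ₗ (singularCohomology.map ℚ ℚ p₁ 1).hom)) :
    Module.End.IsSemisimple ((c₁.transferMap 1).hom ∘ₗ (singularCohomology.map ℚ ℚ p₂ 1).hom) := by
  obtain ⟨r, -, hadj⟩ := D.exists_isAdjointPair_form_one hX c₁ c₂ hE hη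
  haveI := BettiUniverse.finite hX 1
  exact (D.polarization hX (BettiUniverse.realHodgeModel hHD hX)
    (BettiUniverse.realHodgeModel_isHodgeSymmetric hHD hX) 1).isSemisimple_of_isAdjointPair_of_commute
    hT hadj (hc.smul_right r)

end F1Door

end Literature.AlgebraicGeometry.HodgeTheory

end
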